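import Literature.Probability.RandomPlanarGeometry.CurvePinch
import Mathlib.MeasureTheory.Measure.MeasureSpace
import HarnessLib

/-!
# Pinch union bound: two-strand pinch bounds give per-shell decay of the traversal number

Topic `Literature/Probability/RandomPlanarGeometry` (companion to `CurvePinch.lean` and
`CurveTortuosity.lean`).  The one-dimensional-net reduction of Aizenman–Burchard-type traversal
estimates (AB99 §1.b, Lemma 3.1: their tightness criterion needs the exponent to beat the
dimension of the NET; on the middle circle of a shell the net is one-dimensional).  Abstract
setting: a family of measures `μ δ` on spaces `α δ` (meshes `δ > 0`), random curves
`X δ : α δ → Curve ℂ`, two marked points `p₀ p₁`.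

* Hypothesis (a **two-strand pinch bound away from the marked points**): for every `d > 0`
  there are `C`, `s > 0`, `R₀ > 0`, `δ₁ > 0` with
  `μ δ {FOUR separate traversals of D(y; η, R)} ≤ C (η/R)^{1+s}` for `δ ∈ (0, δ₁]`,
  `δ ≤ η < R ≤ R₀` and centres `y` at distance `≥ d` from `p₀` and `p₁`.
* Conclusion (**per-shell decay**): for every genuine shell `D(x; ρ, R)` and `ε > 0` some
  threshold `k` and mesh bound `δ₁ > 0` give `μ δ {k separate traversals of D(x; ρ, R)} ≤ ε` for
  all `δ ∈ (0, δ₁]`.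

Proof (`perShellDecay_of_pinchBound`): choose a middle radius `μ` of a third of the shell at
distance `≥ (R - ρ)/12 =: d` from `dist p₀ x` and `dist p₁ x` (`exists_good_mid`); `k`
traversals of the shell give `k` of the sub-shell `D(x; μ - w/2, μ + w/2)`, `w = (R - ρ)/3`, hence
four of `D(y; 4πμ/k, w/2)` at a point of the circle `|y - x| = μ`
(`Curve.exists_pinch_of_hasTraversals`), hence four of `D(yⱼ; 6πμ/k, R')`,
`R' = min (w/4) R₀`, at one of the `k` net points `yⱼ` (`exists_dist_circleNet_le`,
`Curve.HasTraversals.mono`); the net points are `d`-far from `p₀, p₁`, so a union bound gives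
`μ δ {k traversals} ≤ k · C (η/R')^{1+s} = C (6πμ/R') (η/R')^s ≤ ε` for `k` large, and the
mesh bound `min δ₁(d) η` keeps the clause `δ ≤ η`.  Only monotonicity and finite subadditivity
of (outer) measures are used.

## References
* M. Aizenman, A. Burchard, *Hölder regularity and dimension bounds for random curves*, Duke
  Math. J. 99 (1999), §1.b and Lemma 3.1 [AizenmanBurchardDuke1999].
-/

noncomputable section

open _root_.Set _root_.Metric _root_.MeasureTheory _root_.Real
open scoped ENNReal

namespace Literature.Probability.RandomPlanarGeometry

/-- **Pinch union bound** (two-strand pinch bounds away from two marked points ⇒ per-shell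
decay of the traversal number), for an arbitrary family of measures and random planar curves
indexed by the mesh; see the module docstring for the statement and proof.
[cite: AizenmanBurchardDuke1999, §1.b and Lemma 3.1] -/
theorem perShellDecay_of_pinchBound {α : ℝ → Type*} [∀ δ, MeasurableSpace (α δ)]
    (μ : ∀ δ, Measure (α δ)) (X : ∀ δ, α δ → Curve ℂ) (p₀ p₁ : ℂ)
    (hPA : ∀ d : ℝ, 0 < d → ∃ (C s R₀ δ₁ : ℝ), 0 < s ∧ 0 < R₀ ∧ 0 < δ₁ ∧
      ∀ δ ∈ Set.Ioc (0 : ℝ) δ₁, ∀ (y : ℂ) (η R : ℝ), δ ≤ η → η < R → R ≤ R₀ →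
        d ≤ dist y p₀ → d ≤ dist y p₁ →
          μ δ {ω | (X δ ω).HasTraversals 4 y η R} ≤ ENNReal.ofReal (C * (η / R) ^ (1 + s)))
    (x : ℂ) {ρ R : ℝ} (hρ : 0 < ρ) (hρR : ρ < R) {ε : ℝ} (hε : 0 < ε) :
    ∃ (k : ℕ) (δ₁ : ℝ), 0 < δ₁ ∧ ∀ δ ∈ Set.Ioc (0 : ℝ) δ₁,
      μ δ {ω | (X δ ω).HasTraversals k x ρ R} ≤ ENNReal.ofReal ε := by
  -- Step 1: the good middle radius and its sub-shell
  obtain ⟨m, hm1, hm2, hfa, hfb⟩ := exists_good_mid hρR (dist p₀ x) (dist p₁ x)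
  set w : ℝ := (R - ρ) / 3 with hw_def
  have hw : 0 < w := by rw [hw_def]; linarith
  set ρ₁ : ℝ := m - w / 2 with hρ₁_def
  set R₁ : ℝ := m + w / 2 with hR₁_def
  have hρρ₁ : ρ ≤ ρ₁ := by rw [hρ₁_def, hw_def]; linarith
  have hR₁R : R₁ ≤ R := by rw [hR₁_def, hw_def]; linarith
  have hρ₁pos : 0 ≤ ρ₁ := hρ.le.trans hρρ₁
  have hρ₁R₁ : ρ₁ < R₁ := by rw [hρ₁_def, hR₁_def]; linarith
  have hmpos : 0 < m := by
    have : ρ ≤ m - w / 2 := hρρ₁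
    linarith
  -- Step 2: the pinch bound at distance `d = w/4` from the marked points
  set d : ℝ := w / 4 with hd_def
  have hd : 0 < d := by positivity
  obtain ⟨C, s, R₀, δd, hs, hR₀, hδd, hbound⟩ := hPA d hd
  -- constants
  set C' : ℝ := max C 1 with hC'_def
  have hC' : 1 ≤ C' := le_max_right _ _
  have hC'pos : 0 < C' := lt_of_lt_of_le one_pos hC'
  have hCC' : C ≤ C' := le_max_left _ _
  set R' : ℝ := min (w / 4) R₀ with hR'_def
  have hR' : 0 < R' := lt_min (by positivity) hR₀
  have hR'w : R' ≤ w / 4 := min_le_left _ _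
  have hR'R₀ : R' ≤ R₀ := min_le_right _ _
  have h6 : 0 < 6 * π * m / R' := by positivity
  set ε' : ℝ := ε / (C' * (6 * π * m / R')) with hε'_def
  have hε' : 0 < ε' := div_pos hε (mul_pos hC'pos h6)
  have hE : 0 < ε' ^ s⁻¹ := Real.rpow_pos_of_pos hε' _
  set K₀ : ℝ := max (6 * π * m / (R' * ε' ^ s⁻¹)) (max (6 * π * m / R') (8 * π * m / w))
    with hK₀_def
  set k : ℕ := ⌈K₀⌉₊ + 2 with hk_def
  have hk2 : 2 ≤ k := by omega
  have hk1 : 1 ≤ k := by omega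
  have hkK₀ : K₀ < k := by
    have h1 : K₀ ≤ ⌈K₀⌉₊ := Nat.le_ceil K₀
    have h2 : (k : ℝ) = (⌈K₀⌉₊ : ℝ) + 2 := by rw [hk_def]; push_cast; ring
    rw [h2]
    linarith
  have hkpos : (0 : ℝ) < k := by exact_mod_cast (show 0 < k by omega)
  have hkA : 6 * π * m / (R' * ε' ^ s⁻¹) < k := lt_of_le_of_lt (le_max_left _ _) hkK₀
  have hkB : 6 * π * m / R' < k :=
    lt_of_le_of_lt ((le_max_left _ _).trans (le_max_right _ _)) hkK₀
  have hkC : 8 * π * m / w < k :=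
    lt_of_le_of_lt ((le_max_right _ _).trans (le_max_right _ _)) hkK₀
  set η : ℝ := 6 * π * m / k with hη_def
  have hη : 0 < η := by positivity
  have hηR' : η < R' := by
    rw [hη_def, div_lt_iff₀ hkpos]
    have h1 := (div_lt_iff₀ hR').1 hkB
    calc 6 * π * m < k * R' := h1
      _ = R' * k := mul_comm _ _
  have hnet : 2 * π * m / k ≤ w / 4 := by
    rw [div_le_iff₀ hkpos]
    have h1 := (div_lt_iff₀ hw).1 hkC
    have h2 : 2 * π * m < w / 4 * k := by
      calc 2 * π * m = (8 * π * m) / 4 := by ring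
        _ < k * w / 4 := by linarith
        _ = w / 4 * k := by ring
    exact h2.le
  have hsmall : η / R' ≤ ε' ^ s⁻¹ := by
    rw [hη_def, div_div, div_le_iff₀ (by positivity)]
    have h1 := (div_lt_iff₀ (by positivity)).1 hkA
    calc 6 * π * m ≤ k * (R' * ε' ^ s⁻¹) := h1.le
      _ = ε' ^ s⁻¹ * (k * R') := by ring
  refine ⟨k, min δd η, lt_min hδd hη, fun δ hδ => ?_⟩
  have hδd' : δ ∈ Set.Ioc (0 : ℝ) δd := ⟨hδ.1, hδ.2.trans (min_le_left _ _)⟩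
  have hδη : δ ≤ η := hδ.2.trans (min_le_right _ _)
  -- the net points
  let N : ℕ → ℂ := fun i => x + (m : ℂ) * Complex.exp (((-π + 2 * π * i / k : ℝ) : ℂ) * Complex.I)
  have hNdist : ∀ i, dist (N i) x = m := fun i => by
    show dist (x + (m : ℂ) * Complex.exp (((-π + 2 * π * i / k : ℝ) : ℂ) * Complex.I)) x = m
    rw [dist_eq_norm, add_sub_cancel_left, norm_mul, Complex.norm_real, Real.norm_eq_abs,
      abs_of_nonneg hmpos.le, Complex.norm_exp_ofReal_mul_I, mul_one]
  -- Step 3: the event inclusion (sub-shell, pinch, net)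
  have hsub : {ω | (X δ ω).HasTraversals k x ρ R} ⊆
      ⋃ i : Fin k, {ω | (X δ ω).HasTraversals 4 (N i) η R'} := by
    intro ω hω
    have h1 : (X δ ω).HasTraversals k x ρ₁ R₁ := Curve.HasTraversals.mono' hω hρρ₁ hR₁R
    obtain ⟨y, hyx, h4⟩ := Curve.exists_pinch_of_hasTraversals hρ₁pos hρ₁R₁ hk2 h1
    have hmid : (ρ₁ + R₁) / 2 = m := by rw [hρ₁_def, hR₁_def]; ring
    have hwid : (R₁ - ρ₁) / 2 = w / 2 := by rw [hρ₁_def, hR₁_def]; ring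
    rw [hmid] at hyx h4
    rw [hwid] at h4
    obtain ⟨i, hik, hdist⟩ := exists_dist_circleNet_le hmpos hyx hk1
    refine Set.mem_iUnion.2 ⟨⟨i, hik⟩, ?_⟩
    show (X δ ω).HasTraversals 4 (N i) η R'
    refine Curve.HasTraversals.mono h4 ?_ ?_
    · have : 4 * π * m / k + 2 * π * m / k = η := by rw [hη_def]; ring
      have hdist' : dist y (N i) ≤ 2 * π * m / k := hdist
      linarith
    · have hdist' : dist y (N i) ≤ 2 * π * m / k := hdist
      linarith
  -- distances of the net points from the marked points
  have hfar : ∀ (p : ℂ) (i : ℕ), (R - ρ) / 12 ≤ |dist p x - m| → d ≤ dist (N i) p := by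
    intro p i hp
    have h1 := abs_dist_sub_le p (N i) x
    rw [hNdist i] at h1
    rw [dist_comm]
    have : d = (R - ρ) / 12 := by rw [hd_def, hw_def]; ring
    linarith
  -- Step 4: the union bound
  have hq : 0 < η / R' := div_pos hη hR'
  calc μ δ {ω | (X δ ω).HasTraversals k x ρ R}
      ≤ μ δ (⋃ i : Fin k, {ω | (X δ ω).HasTraversals 4 (N i) η R'}) := measure_mono hsub
    _ ≤ ∑ i : Fin k, μ δ {ω | (X δ ω).HasTraversals 4 (N i) η R'} :=
        measure_iUnion_fintype_le _ _
    _ ≤ ∑ _i : Fin k, ENNReal.ofReal (C' * (η / R') ^ (1 + s)) := by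
        refine Finset.sum_le_sum fun i _ => ?_
        calc μ δ {ω | (X δ ω).HasTraversals 4 (N i) η R'}
            ≤ ENNReal.ofReal (C * (η / R') ^ (1 + s)) :=
              hbound δ hδd' (N i) η R' hδη hηR' hR'R₀ (hfar _ _ hfa) (hfar _ _ hfb)
          _ ≤ ENNReal.ofReal (C' * (η / R') ^ (1 + s)) := by
              apply ENNReal.ofReal_le_ofReal
              exact mul_le_mul_of_nonneg_right hCC' (Real.rpow_nonneg hq.le _)
    _ = ENNReal.ofReal (k * (C' * (η / R') ^ (1 + s))) := by
        rw [Finset.sum_const, Finset.card_univ, Fintype.card_fin, nsmul_eq_mul,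
          ENNReal.ofReal_mul (Nat.cast_nonneg k), ENNReal.ofReal_natCast]
    _ ≤ ENNReal.ofReal ε := ENNReal.ofReal_le_ofReal ?_
  -- Step 5: `k · C' · (η/R')^{1+s} ≤ ε`
  have hpow : (η / R') ^ (1 + s) = (η / R') * (η / R') ^ s := by
    rw [Real.rpow_add hq, Real.rpow_one]
  have hs' : (η / R') ^ s ≤ ε' := by
    calc (η / R') ^ s ≤ (ε' ^ s⁻¹) ^ s := Real.rpow_le_rpow hq.le hsmall hs.le
      _ = ε' := Real.rpow_inv_rpow hε'.le hs.ne'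
  have hkη : (k : ℝ) * η = 6 * π * m := by
    rw [hη_def]
    field_simp
  calc (k : ℝ) * (C' * (η / R') ^ (1 + s)) = C' * ((k * η) / R') * (η / R') ^ s := by
        rw [hpow]
        ring
    _ = C' * (6 * π * m / R') * (η / R') ^ s := by rw [hkη]
    _ ≤ C' * (6 * π * m / R') * ε' := by gcongr
    _ = ε := by
        rw [hε'_def]
        field_simp

end Literature.Probability.RandomPlanarGeometry

end
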